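import Summits.NavierStokesRegularity.NavierStokesRegularity.Theorems.PoloidalWindowDoorPoloidalWindowRigidityZShockCompactDisturbance
import Summits.NavierStokesRegularity.NavierStokesRegularity.Theorems.PoloidalWindowDoorPoloidalWindowRigidityZShockQuietTools
import HarnessLib

/-!
# Crux K2 `PoloidalWindowRigidity` (stmt-NavierStokesRegularity-19708), line `z_shock` — ★ R2 WITHOUT ANY SIGN HYPOTHESIS FOR
# SOLUTIONS THAT SETTLE TO A CONSTANT VALUE OF `w` AT ONE HEIGHT END

`--supports stmt-NavierStokesRegularity-19708 --as helper` (leafhand-ns-poloidalwindowdoor-3 g3, cell decomp-ns, 2026-08-31).  Class-free,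
Mathlib + tree files only.  **No stub and no summit is closed by this file; Navier–Stokes regularity is NOT proved here (rung 0).**

`pSystem_const_of_quiet_future` — let `(w, p)` be differentiable and solve the autonomous p-system `p_z = −κ(w)² w_x`, `w_z = −p_x`
on `ℝ × ℝ` (two-sided in the height `z`), with `0 < κlo ≤ κ(w) ≤ κhi`, `|κ'(w)| ≤ k₁`, `|w_x| ≤ W₁` along the solution, `κ > 0`,
`κ ∈ C¹` NOWHERE LINEARLY DEGENERATE, and NO hypothesis on the sign of `κ'`.  If `w(z, ·) → w∞` UNIFORMLY in `x` as `z → +∞` (ONE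
height end; nothing is assumed about `p`, nor about `κ'(w∞)`), then `(w, p)` is constant.  `pSystem_const_of_quiet_past` is the twin
for `z → −∞` (point reflection `(z, x) ↦ (−z, −x)`).  This supersedes `…ZShockQuietHeights` (p824047: both ends and `κ'(w∞) ≠ 0`).

Proof (no Riccati equation at all).  With `r, s = p ± K(w)`: (1) along the forward characteristic `X₀` from `(0, x₀)`, `r ≡ r(0, x₀)`,
so `s(z, X₀ z) = r(0, x₀) − 2K(w(z, X₀ z)) → L(x₀) := r(0, x₀) − 2K(w∞)`.  (2) For `x₀ ≤ x₁` the characteristics are ordered,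
`X₀ ≤ X₁` (ODE uniqueness), and their gap `g = X₁ − X₀` has `g' = κ(w∘X₁) − κ(w∘X₀) → 0`, so eventually `g(z) ≤ g(Z) + κlo (z − Z)`.
(3) The backward characteristic `Y` through `(z, X₀ z)` meets `X₁` at a height `t* ∈ [z − g(z)/(2κlo), z]` (relative speed `≥ 2κlo`),
and `s` is constant along `Y`: `s(z, X₀ z) = s(t*, X₁ t*)`.  Since `t* ≥ z/2 − const → ∞`, the left side tends to `L(x₀)` and the right
side to `L(x₁)`: `r(0, x₀) = r(0, x₁)`.  (4) So `r` is constant on the slice, hence on `ℝ × ℝ` (transport), the solution is forward-flat,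
and `…ZShockScalarEternal.pSystem_const_of_forward_flat` (lines cross; no sign) finishes. [folklore]
-/

noncomputable section

namespace Summit.NavierStokesRegularity.NavierStokesRegularity.Theorems.PoloidalWindowDoorPoloidalWindowRigidityZShockQuietFuture

-- the summit and its single sub-problem share the name (CONVENTIONS §1)
set_option linter.dupNamespace false

open Set Filter Topology Function Metric
open scoped NNReal
open Summit.NavierStokesRegularity.NavierStokesRegularity.Theorems.PoloidalWindowDoorPoloidalWindowRigidityZShockPSystemNonuniform
open Summit.NavierStokesRegularity.NavierStokesRegularity.Theorems.PoloidalWindowDoorPoloidalWindowRigidityZShockScalarEternal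
open Summit.NavierStokesRegularity.NavierStokesRegularity.Theorems.PoloidalWindowDoorPoloidalWindowRigidityZShockQuietTools

variable {w p : ℝ × ℝ → ℝ} {κ κ' K : ℝ → ℝ} {κlo κhi k₁ W₁ winf : ℝ}

/-- **★ R2 without sign hypothesis, future-quiet solutions** (hypotheses and proof in the module docstring). [folklore] -/
theorem pSystem_const_of_quiet_future (hw : Differentiable ℝ w) (hp : Differentiable ℝ p)
    (hKd : ∀ v, HasDerivAt K (κ v) v) (hκd : ∀ v, HasDerivAt κ (κ' v) v)
    (hsys1 : ∀ q, fderiv ℝ p q (1, 0) = -(κ (w q) ^ 2 * fderiv ℝ w q (0, 1)))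
    (hsys2 : ∀ q, fderiv ℝ w q (1, 0) = -fderiv ℝ p q (0, 1))
    (hκlo0 : 0 < κlo) (hκlo : ∀ q, κlo ≤ κ (w q)) (hκhi : ∀ q, κ (w q) ≤ κhi)
    (hκpos : ∀ v, 0 < κ v) (hgn : ∀ a b : ℝ, a < b → ∃ v ∈ Ioo a b, κ' v ≠ 0)
    (hk₁ : ∀ q, |κ' (w q)| ≤ k₁) (hW₁ : ∀ q, |fderiv ℝ w q (0, 1)| ≤ W₁)
    (hTop : ∀ ε > 0, ∃ Z : ℝ, ∀ z x : ℝ, Z ≤ z → |w (z, x) - winf| < ε) :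
    ∀ q q' : ℝ × ℝ, w q = w q' ∧ p q = p q' := by
  have hKc : Continuous K := continuous_iff_continuousAt.2 fun v => (hKd v).continuousAt
  have hκc : Continuous κ := continuous_iff_continuousAt.2 fun v => (hκd v).continuousAt
  have hκB : ∀ q, |κ (w q)| ≤ κhi := fun q => by rw [abs_of_pos (hκpos _)]; exact hκhi q
  -- Riemann invariants and the two transport equations
  set r : ℝ × ℝ → ℝ := fun q => p q + K (w q) with hrdef
  set s : ℝ × ℝ → ℝ := fun q => p q - K (w q) with hsdef
  have hKw : ∀ q, HasFDerivAt (fun q' => K (w q')) (κ (w q) • fderiv ℝ w q) q :=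
    fun q => (hKd (w q)).comp_hasFDerivAt q (hw q).hasFDerivAt
  have hrF : ∀ q, HasFDerivAt r (fderiv ℝ p q + κ (w q) • fderiv ℝ w q) q := fun q => (hp q).hasFDerivAt.add (hKw q)
  have hsF : ∀ q, HasFDerivAt s (fderiv ℝ p q - κ (w q) • fderiv ℝ w q) q := fun q => (hp q).hasFDerivAt.sub (hKw q)
  have hr1 : Differentiable ℝ r := fun q => (hrF q).differentiableAt
  have hs1 : Differentiable ℝ s := fun q => (hsF q).differentiableAt
  have hrD : ∀ q v, fderiv ℝ r q v = fderiv ℝ p q v + κ (w q) * fderiv ℝ w q v := by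
    intro q v; rw [(hrF q).fderiv]; simp [smul_eq_mul]
  have hsD : ∀ q v, fderiv ℝ s q v = fderiv ℝ p q v - κ (w q) * fderiv ℝ w q v := by
    intro q v; rw [(hsF q).fderiv]; simp [smul_eq_mul]
  have hPDE1 : ∀ q, fderiv ℝ r q (1, 0) + (fun q => κ (w q)) q * fderiv ℝ r q (0, 1) = 0 := by
    intro q; simp only; rw [hrD, hrD, hsys1, hsys2]; ring
  have hPDE2 : ∀ q, fderiv ℝ s q (1, 0) + (fun q => -κ (w q)) q * fderiv ℝ s q (0, 1) = 0 := by
    intro q; simp only; rw [hsD, hsD, hsys1, hsys2]; ring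
  have hκd' : ∀ v, HasDerivAt (fun v => -κ v) ((fun v => -κ' v) v) v := fun v => (hκd v).neg
  have hκB' : ∀ q, |(fun v => -κ v) (w q)| ≤ κhi := fun q => by simp only [abs_neg]; exact hκB q
  have hk₁' : ∀ q, |(fun v => -κ' v) (w q)| ≤ k₁ := fun q => by simp only [abs_neg]; exact hk₁ q
  -- the forward speed field is uniformly Lipschitz in `x` (for the ordering of characteristics)
  have hκw : ∀ q, HasFDerivAt (fun q' => κ (w q')) (κ' (w q) • fderiv ℝ w q) q :=
    fun q => (hκd (w q)).comp_hasFDerivAt q (hw q).hasFDerivAt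
  have hLip : ∀ z, LipschitzWith (k₁ * W₁).toNNReal (fun x : ℝ => κ (w (z, x))) := by
    intro z
    have hsl : ∀ x, HasDerivAt (fun x' : ℝ => κ (w (z, x'))) (κ' (w (z, x)) * fderiv ℝ w (z, x) (0, 1)) x := by
      intro x
      have hγ : HasDerivAt (fun x' : ℝ => ((z, x') : ℝ × ℝ)) ((0 : ℝ), (1 : ℝ)) x :=
        (hasDerivAt_const x z).prodMk (hasDerivAt_id x)
      have h := (hκw (z, x)).comp_hasDerivAt x hγ
      exact h.congr_deriv (by simp [smul_eq_mul])
    refine lipschitzWith_of_nnnorm_deriv_le (fun x => (hsl x).differentiableAt) fun x => ?_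
    rw [(hsl x).deriv, ← NNReal.coe_le_coe, coe_nnnorm, Real.norm_eq_abs, abs_mul]
    refine le_trans ?_ (Real.le_coe_toNNReal _)
    exact mul_le_mul (hk₁ (z, x)) (hW₁ (z, x)) (abs_nonneg _) ((abs_nonneg _).trans (hk₁ (z, x)))
  -- (1) the limit of `s` along the forward characteristic from `(0, x₀)`
  have hkey : ∀ x₀ x₁ : ℝ, x₀ ≤ x₁ → r (0, x₀) = r (0, x₁) := by
    intro x₀ x₁ hx
    obtain ⟨X₀, hX00, hX0⟩ := exists_global_char hw hκd hκB hk₁ hW₁ 0 x₀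
    obtain ⟨X₁, hX10, hX1⟩ := exists_global_char hw hκd hκB hk₁ hW₁ 0 x₁
    have hrX : ∀ (X : ℝ → ℝ) (x : ℝ), X 0 = x → (∀ z, HasDerivAt X (κ (w (z, X z))) z) → ∀ z, r (z, X z) = r (0, x) := by
      intro X x hX0' hX z
      have h := const_along (c := fun q => κ (w q)) hr1 hPDE1 hX z 0
      rwa [hX0'] at h
    have hsr : ∀ q, s q = r q - 2 * K (w q) := fun q => by simp only [hrdef, hsdef]; ring
    -- `w ∘ X → winf`, hence `s ∘ X → r(0, x) − 2 K(winf)`, for both characteristics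
    have hwlim : ∀ X : ℝ → ℝ, Tendsto (fun z => w (z, X z)) atTop (𝓝 winf) := by
      intro X
      rw [Metric.tendsto_atTop]
      intro ε hε
      obtain ⟨Z, hZ⟩ := hTop ε hε
      exact ⟨Z, fun z hz => by rw [Real.dist_eq]; exact hZ z (X z) hz⟩
    have hslim : ∀ (X : ℝ → ℝ) (x : ℝ), X 0 = x → (∀ z, HasDerivAt X (κ (w (z, X z))) z) →
        Tendsto (fun z => s (z, X z)) atTop (𝓝 (r (0, x) - 2 * K winf)) := by
      intro X x hX0' hX
      have h1 : Tendsto (fun z => K (w (z, X z))) atTop (𝓝 (K winf)) := (hKc.tendsto winf).comp (hwlim X)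
      have h2 := (tendsto_const_nhds (x := r (0, x))).sub (h1.const_mul 2)
      refine h2.congr fun z => ?_
      rw [hsr, hrX X x hX0' hX z]
    have hL0 := hslim X₀ x₀ hX00 hX0
    have hL1 := hslim X₁ x₁ hX10 hX1
    -- (2) ordering and gap control
    have hord : ∀ z, X₀ z ≤ X₁ z :=
      le_of_le_char (F := fun z x => κ (w (z, x))) hLip hX0 hX1 (z₀ := 0) (by rw [hX00, hX10]; exact hx)
    set g : ℝ → ℝ := fun z => X₁ z - X₀ z with hg
    have hgd : ∀ z, HasDerivAt g (κ (w (z, X₁ z)) - κ (w (z, X₀ z))) z := fun z => (hX1 z).sub (hX0 z)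
    have hg0 : ∀ z, 0 ≤ g z := fun z => by simp only [hg]; linarith [hord z]
    obtain ⟨Z, hZ⟩ : ∃ Z : ℝ, ∀ z, Z ≤ z → κ (w (z, X₁ z)) - κ (w (z, X₀ z)) ≤ κlo := by
      have hκev : ∀ᶠ u in 𝓝 winf, |κ u - κ winf| < κlo / 2 := by
        have h := (hκc.continuousAt (x := winf)).sub (continuousAt_const (y := κ winf))
        have h2 := h.norm.eventually_lt_const
          (show ‖κ winf - κ winf‖ < κlo / 2 by rw [sub_self, norm_zero]; positivity)
        simpa [Real.norm_eq_abs] using h2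
      obtain ⟨δ, hδ, hδκ⟩ := Metric.eventually_nhds_iff.1 hκev
      obtain ⟨Z, hZ⟩ := hTop δ hδ
      refine ⟨Z, fun z hz => ?_⟩
      have h1 := hδκ (show dist (w (z, X₁ z)) winf < δ by rw [Real.dist_eq]; exact hZ z (X₁ z) hz)
      have h0 := hδκ (show dist (w (z, X₀ z)) winf < δ by rw [Real.dist_eq]; exact hZ z (X₀ z) hz)
      rw [abs_lt] at h1 h0
      linarith [h1.2, h0.1]
    have hgrow : ∀ z, Z < z → g z ≤ g Z + κlo * (z - Z) := by
      intro z hz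
      have h := slope_ge_of_deriv_ge (ψ := fun t => -g t) (β := fun t => -(κ (w (t, X₁ t)) - κ (w (t, X₀ t))))
        (b₀ := -κlo) (fun t => (hgd t).neg) hz (fun t ht => by linarith [hZ t ht.1.le])
      linarith
    -- (3) `s (z, X₀ z)` also tends to the limit along `X₁`
    have hL1' : Tendsto (fun z => s (z, X₀ z)) atTop (𝓝 (r (0, x₁) - 2 * K winf)) := by
      rw [Metric.tendsto_atTop]
      intro ε hε
      obtain ⟨T₁, hT₁⟩ := Metric.tendsto_atTop.1 hL1 ε hε
      refine ⟨max Z (2 * (T₁ + g Z / (2 * κlo)) - Z) + 1, fun z hz => ?_⟩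
      have hzZ : Z < z := by linarith [le_max_left Z (2 * (T₁ + g Z / (2 * κlo)) - Z)]
      have hz2 : 2 * (T₁ + g Z / (2 * κlo)) - Z < z := by
        linarith [le_max_right Z (2 * (T₁ + g Z / (2 * κlo)) - Z)]
      -- the backward characteristic through `(z, X₀ z)` meets `X₁` at a height `t* ≥ z − g z / (2κlo)`
      obtain ⟨Y, hY0, hY⟩ := exists_global_char (c := fun v => -κ v) hw hκd' hκB' hk₁' hW₁ z (X₀ z)
      set D : ℝ → ℝ := fun t => X₁ t - Y t with hD
      have hDd : ∀ t, HasDerivAt D (κ (w (t, X₁ t)) - -κ (w (t, Y t))) t := fun t => (hX1 t).sub (hY t)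
      have hDc : Continuous D := continuous_iff_continuousAt.2 fun t => (hDd t).continuousAt
      have hDz : D z = g z := by simp only [hD, hg, hY0]
      set t₁ : ℝ := z - g z / (2 * κlo) with ht₁
      have ht₁z : t₁ ≤ z := by
        have : 0 ≤ g z / (2 * κlo) := div_nonneg (hg0 z) (by positivity)
        rw [ht₁]; linarith
      have hDt₁ : D t₁ ≤ 0 := by
        rcases ht₁z.eq_or_lt with heq | hlt
        · have hgz : g z = 0 := by
            have : g z / (2 * κlo) = 0 := by rw [ht₁] at heq; linarith
            rcases div_eq_zero_iff.1 this with h | h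
            · exact h
            · exfalso; linarith
          rw [heq, hDz, hgz]
        · have h := slope_ge_of_deriv_ge (b₀ := 2 * κlo) hDd hlt
            (fun t _ => by linarith [hκlo (t, X₁ t), hκlo (t, Y t)])
          have h2 : 2 * κlo * (z - t₁) = g z := by rw [ht₁]; field_simp; ring
          rw [hDz] at h
          linarith
      obtain ⟨tstar, hts, hDts⟩ : ∃ t ∈ Icc t₁ z, D t = 0 := by
        have h0 : (0 : ℝ) ∈ Icc (D t₁) (D z) := ⟨hDt₁, by rw [hDz]; exact hg0 z⟩
        exact intermediate_value_Icc ht₁z hDc.continuousOn h0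
      have hmeet : Y tstar = X₁ tstar := by simp only [hD] at hDts; linarith
      -- `s` is constant along `Y`
      have hsY : s (z, X₀ z) = s (tstar, X₁ tstar) := by
        have h := const_along (c := fun q => -κ (w q)) hs1 hPDE2 hY z tstar
        rw [hY0, hmeet] at h
        exact h
      -- `t* ≥ T₁`
      have hbig : T₁ ≤ tstar := by
        have h1 : t₁ ≤ tstar := hts.1
        have h2 := hgrow z hzZ
        have h3 : g z / (2 * κlo) ≤ (g Z + κlo * (z - Z)) / (2 * κlo) :=
          div_le_div_of_nonneg_right h2 (by positivity)
        have h4 : (g Z + κlo * (z - Z)) / (2 * κlo) = g Z / (2 * κlo) + (z - Z) / 2 := by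
          field_simp
        rw [ht₁] at h1
        linarith
      rw [hsY]
      exact hT₁ tstar hbig
    have hLeq := tendsto_nhds_unique hL0 hL1'
    linarith
  -- (4) `r` is constant on the slice, hence on `ℝ × ℝ`; the solution is forward-flat
  have hρ : ∀ x, r (0, x) = r (0, 0) := fun x => by
    rcases le_total x 0 with h | h
    · exact hkey x 0 h
    · exact (hkey 0 x h).symm
  have hrconst : ∀ q : ℝ × ℝ, r q = r (0, 0) := by
    rintro ⟨z, x⟩
    obtain ⟨X, hX0, hX⟩ := exists_global_char hw hκd hκB hk₁ hW₁ z x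
    have h := const_along (c := fun q => κ (w q)) hr1 hPDE1 hX z 0
    rw [hX0] at h
    rw [h, hρ]
  have hflat : ∀ q, fderiv ℝ p q (0, 1) + κ (w q) * fderiv ℝ w q (0, 1) = 0 := by
    intro q
    rw [← hrD, show r = fun _ => r (0, 0) from funext hrconst]
    simp
  exact pSystem_const_of_forward_flat hw hp hκd hsys1 hsys2 hκpos hκhi hk₁ hW₁ hgn hflat

/-- **Past-quiet twin** (`w(z, ·) → w∞` uniformly as `z → −∞` ⇒ constant), by the point reflection `(z, x) ↦ (−z, −x)`, which maps
solutions to solutions (template: `…PSystemNonuniformConst.forward_gradient_nonneg`). [folklore] -/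
theorem pSystem_const_of_quiet_past (hw : Differentiable ℝ w) (hp : Differentiable ℝ p)
    (hKd : ∀ v, HasDerivAt K (κ v) v) (hκd : ∀ v, HasDerivAt κ (κ' v) v)
    (hsys1 : ∀ q, fderiv ℝ p q (1, 0) = -(κ (w q) ^ 2 * fderiv ℝ w q (0, 1)))
    (hsys2 : ∀ q, fderiv ℝ w q (1, 0) = -fderiv ℝ p q (0, 1))
    (hκlo0 : 0 < κlo) (hκlo : ∀ q, κlo ≤ κ (w q)) (hκhi : ∀ q, κ (w q) ≤ κhi)
    (hκpos : ∀ v, 0 < κ v) (hgn : ∀ a b : ℝ, a < b → ∃ v ∈ Ioo a b, κ' v ≠ 0)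
    (hk₁ : ∀ q, |κ' (w q)| ≤ k₁) (hW₁ : ∀ q, |fderiv ℝ w q (0, 1)| ≤ W₁)
    (hBot : ∀ ε > 0, ∃ Z : ℝ, ∀ z x : ℝ, z ≤ Z → |w (z, x) - winf| < ε) :
    ∀ q q' : ℝ × ℝ, w q = w q' ∧ p q = p q' := by
  set w' : ℝ × ℝ → ℝ := fun q => w (-q) with hw'
  set p' : ℝ × ℝ → ℝ := fun q => p (-q) with hp'
  have hneg : Differentiable ℝ fun q : ℝ × ℝ => -q := differentiable_id.neg
  have hw'1 : Differentiable ℝ w' := hw.comp hneg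
  have hp'1 : Differentiable ℝ p' := hp.comp hneg
  have hw'D : ∀ q v, fderiv ℝ w' q v = -fderiv ℝ w (-q) v := by
    intro q v
    have h := ((hw (-q)).hasFDerivAt.comp q ((hasFDerivAt_id q).neg)).fderiv
    rw [show w' = w ∘ Neg.neg from rfl, h]
    simp
  have hp'D : ∀ q v, fderiv ℝ p' q v = -fderiv ℝ p (-q) v := by
    intro q v
    have h := ((hp (-q)).hasFDerivAt.comp q ((hasFDerivAt_id q).neg)).fderiv
    rw [show p' = p ∘ Neg.neg from rfl, h]
    simp
  have hsys1' : ∀ q, fderiv ℝ p' q (1, 0) = -(κ (w' q) ^ 2 * fderiv ℝ w' q (0, 1)) := by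
    intro q; rw [hp'D, hw'D, hsys1]; ring
  have hsys2' : ∀ q, fderiv ℝ w' q (1, 0) = -fderiv ℝ p' q (0, 1) := by
    intro q; rw [hw'D, hp'D, hsys2]
  have hTop' : ∀ ε > 0, ∃ Z : ℝ, ∀ z x : ℝ, Z ≤ z → |w' (z, x) - winf| < ε := by
    intro ε hε
    obtain ⟨Z, hZ⟩ := hBot ε hε
    refine ⟨-Z, fun z x hz => ?_⟩
    have h := hZ (-z) (-x) (by linarith)
    simpa [hw'] using h
  have h := pSystem_const_of_quiet_future hw'1 hp'1 hKd hκd hsys1' hsys2' hκlo0 (fun q => hκlo (-q))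
    (fun q => hκhi (-q)) hκpos hgn (fun q => hk₁ (-q))
    (fun q => by rw [hw'D, abs_neg]; exact hW₁ (-q)) hTop'
  intro q q'
  obtain ⟨h1, h2⟩ := h (-q) (-q')
  simp only [hw', hp', neg_neg] at h1 h2
  exact ⟨h1, h2⟩

end Summit.NavierStokesRegularity.NavierStokesRegularity.Theorems.PoloidalWindowDoorPoloidalWindowRigidityZShockQuietFuture

end
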